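import Summits.QuantumAdvantage.QuantumAdvantage.Theorems.CubicForrelationNearExactIsExactTwelveLevelFiveOffFlat

/-!
# Crux `CubicForrelation.NearExactIsExact` (stmt-QuantumAdvantage-14043) — n = 12, INSIDE the open window: a level-5 side against a type-E
  partner with `Φ ≥ 955/1024` is exact

Certificate seat `b2b-cforr-cert` (gen 13).  HONEST FRAMING: a kernel-checked THEOREM (standard axioms) about cubic Boolean pairs on 12 bits,
strictly inside the open window `θ₁₂ ∈ [57/64, 15/16)`; the second type-E branch of "`Φ ≥ 955/1024 ⇒ Φ = 1` on 12 bits"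
(`…TwelveWindow955.lean`).  It is genuinely TWO-SIDED: the last step uses that the partner's spectrum lies in `32ℤ`.  NOT summit progress.

THEOREM `tw5_levelFive_window`: cubic `f, g : 𝔽₂¹² → 𝔽₂`, `W_g = 32·u'` with some `u'(x)` odd (level 5), `W_f ∈ 32ℤ` pointwise, and
`Φ(f,g) ≥ 955/1024` ⇒ `Φ(f,g) = 1`.  (Tree: the boundary case `Φ ≥ 15/16`, `z2_levelOne_false` at `r = 2` / `tw12_isolation_ge`.)

## Proof (`s = (−1)^f`, `e = u' − 2s`, `B := Σ e² = 2¹⁵(1 − Φ)`; `Φ ∈ [955/1024, 15/16)` means `2048 < B ≤ 2208`)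
* `P = {u' odd}` is the support of a non-zero affine function (`stub_walshTower`), each of its points costs `e² ≥ 1`, and its complement is
  also a non-empty affine support: `#P = 2048`, `P = x_P ⊕ V` (`mw_flat_of_minweight`), `Σ_{x∉P} e² ≤ 160`, `Σ_P (e² − 1) ≤ 160`.
* `tw5_off_flat`: `e = 0` off `P`.
* The digit `D = [⌊u'/2⌋ odd]` is cubic (`tw5_digit`) and on `P`: `e ≡ σ := −(−1)^D (mod 4)`, `e = σ + 4ω`.  7-flat sums inside `P`:
  `16 ∣ Σ e` (flat sums of `u'` and Ax for `s`), `8 ∣ Σ σ` (Ax for the cubic `D` on a 7-flat), so `Σ ω` is even on every 7-flat of `P` and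
  (`ws_erm_round`, `r = 6` on the 11-flat) `ω` is odd at `≥ 32` points — cost `≥ 8` each, `256 > 160` — or even everywhere: `e = σ + 8m`.
  A point with `m ≠ 0` costs `e² − 1 ≥ 48`, so the wild set `Wd = {m ≠ 0}` has `≤ 3` points, `|m| = 1` there, and `Wd ≠ ∅` since `B > 2048`.
* TWO-SIDED STEP.  Walsh inversion of `W_g = 32u'` at `z = 0` and `z = e_j`: `Σ_x u' χ_z = 128(−1)^{g(z)}`; with `u' = 2s + e`, `Σ_x s χ_z =
  W_f(z) ∈ 32ℤ` and `e = 1_P(σ + 8m)`: `Σ_P σχ_z + 8Σ_P mχ_z ≡ 0 (mod 64)`.  Ax over the hyperplane `P` and over `P ∩ {x_j = 0}` (`tw5_axP`)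
  gives `16 ∣ Σ_P σ`, `16 ∣ Σ_{P, x_j=0} σ`; hence `Σ_P m` and `Σ_{P, x_j = 0} m` are even, i.e. `#Wd` and `#(Wd ∩ {x_j = 0})` are even.
  So `Wd = {y₁, y₂}`; a coordinate `j` with `y₁(j) ≠ y₂(j)` makes `#(Wd ∩ {x_j = 0}) = 1` — contradiction.
What it does NOT do: below `955/1024` (slack `≥ 192`) a wild 2-flat `ω = −2σ` on four points passes every step above; nothing here is
uniform in `n`.

References: J. Ax (1964) / R. J. McEliece (1972); MacWilliams–Sloane (1977) Ch. 13–15; C. Carlet (2021) §2–4; R. O'Donnell (2014) §3.3.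
Everything below is proved from Mathlib and the tree; axioms are the standard three.
-/

set_option linter.dupNamespace false -- D-0017: single-problem summit ⇒ `QuantumAdvantage.QuantumAdvantage` by design

noncomputable section

namespace Summit.QuantumAdvantage.QuantumAdvantage.Theorems.CubicForrelation.NearExactIsExact

open Finset
open Literature.Computability.QuantumComplexity
open Literature.Computability.QuantumComplexity.BuzetChailloux (bxor zeroVec bxor_bxor_cancel_left bxor_zeroVec zeroVec_bxor bxor_comm
  bxor_self twist_zeroVec_right)
open Literature.Computability.QuantumComplexity.Simon (twist_eq_one_or)
open Literature.Computability.QuantumComplexity.DerivativeWalsh (W)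

/-! ### Level 5 on 12 bits: the theorem -/

/-- **Level 5 on 12 bits: `Φ ≥ 955/1024 ⇒ Φ = 1`.**  For cubic `f, g : 𝔽₂¹² → 𝔽₂` with `W_g = 32·u'`, some `u'(x)` odd, every Walsh
value of `f` in `32ℤ` (the partner is type E) and `Φ(f,g) ≥ 955/1024`, the pair is exact.  Finite-slice statement; NOT summit progress.
[this work] -/
theorem tw5_levelFive_window (f g : (Fin (6 + 6) → Bool) → Bool) (hf : IsDegLeFun 3 f) (hg : IsDegLeFun 3 g)
    (u' : (Fin (6 + 6) → Bool) → ℤ) (hu' : ∀ x, W (fun y => signOf (g y)) x = (2 : ℝ) ^ 5 * (u' x : ℝ))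
    (hodd : ∃ x, Odd (u' x)) (hfE : ∀ z, ∃ k : ℤ, W (fun y => signOf (f y)) z = 32 * (k : ℝ))
    (hΦ : (955 / 1024 : ℝ) ≤ forrelation f g) : forrelation f g = 1 := by
  classical
  by_cases h1516 : (15 / 16 : ℝ) ≤ forrelation f g
  · exact tw12_isolation_ge f g hf hg h1516
  exfalso
  push Not at h1516
  -- `u = 2u'` at the Ax level `4`; residual `e = u' − 2s`, budget `B = Σ e² = 2¹⁵(1 − Φ) ∈ (2048, 2208]`
  set u : (Fin (6 + 6) → Bool) → ℤ := fun x => 2 * u' x with hudef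
  have hu : ∀ x, W (fun y => signOf (g y)) x = (2 : ℝ) ^ 4 * (u x : ℝ) := by
    intro x; rw [hu' x]; simp only [u]; push_cast; ring
  set e : (Fin (6 + 6) → Bool) → ℤ := fun x => u' x - 2 * sZ (f x) with hedef
  have hbud := tw12_budget f g u hu
  have h4e : ∀ x, (u x - 4 * sZ (f x)) ^ 2 = 4 * e x ^ 2 := fun x => by simp only [u, e]; ring
  have hBR : ((∑ x, e x ^ 2 : ℤ) : ℝ) = 32768 * (1 - forrelation f g) := by
    have h' : ((∑ x, (u x - 4 * sZ (f x)) ^ 2 : ℤ) : ℝ) = 4 * ((∑ x, e x ^ 2 : ℤ) : ℝ) := by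
      rw [sum_congr rfl fun x _ => h4e x, ← mul_sum]; push_cast; ring
    rw [h'] at hbud
    linarith
  have hB_le : (∑ x, e x ^ 2 : ℤ) ≤ 2208 := by
    have h' : ((∑ x, e x ^ 2 : ℤ) : ℝ) ≤ 2208 := by rw [hBR]; linarith
    exact_mod_cast h'
  have hB_gt : 2048 < (∑ x, e x ^ 2 : ℤ) := by
    have h' : (2048 : ℝ) < ((∑ x, e x ^ 2 : ℤ) : ℝ) := by rw [hBR]; linarith
    exact_mod_cast h'
  -- the odd set `P` of `u'` is an affine hyperplane
  have hℓ : IsDegLeFun 1 (fun x => decide (Odd (u' x))) :=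
    stub_walshTower stub_axParity (6 + 6) 5 1 g u' hg hu' (by intro k hk hkn; omega)
  set P := univ.filter (fun x : Fin (6 + 6) → Bool => Odd (u' x)) with hPdef
  have hmemP : ∀ x, x ∈ P ↔ Odd (u' x) := fun x => by simp [hPdef]
  have heodd : ∀ x, x ∈ P → Odd (e x) := by
    intro x hx
    exact Int.odd_sub.2 (iff_of_true ((hmemP x).1 hx) ⟨sZ (f x), two_mul _⟩)
  have hsq1 : ∀ x, x ∈ P → 1 ≤ e x ^ 2 := by
    intro x hx
    have h0 := Int.odd_iff.1 (heodd x hx)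
    have : e x ≤ -1 ∨ 1 ≤ e x := by omega
    have := tp_sq_ge (k := 1) (by norm_num) this
    linarith
  have hsplit : (∑ x, e x ^ 2 : ℤ) = ∑ x ∈ P, e x ^ 2 + ∑ x ∈ univ.filter (fun x => x ∉ P), e x ^ 2 := by
    rw [← sum_filter_add_sum_filter_not univ (fun x => x ∈ P)]
    congr 1
    exact sum_congr (by ext x; simp) fun _ _ => rfl
  have hoff_nn : 0 ≤ ∑ x ∈ univ.filter (fun x => x ∉ P), e x ^ 2 := sum_nonneg fun x _ => sq_nonneg _
  have hPle : (#P : ℤ) ≤ 2208 := by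
    have h1 : (#P : ℤ) = ∑ x ∈ P, (1 : ℤ) := by rw [sum_const, nsmul_eq_mul, mul_one]
    have h2 : ∑ x ∈ P, (1 : ℤ) ≤ ∑ x ∈ P, e x ^ 2 := sum_le_sum fun x hx => hsq1 x hx
    linarith
  have hfilt : (univ.filter fun x : Fin (6 + 6) → Bool => decide (Odd (u' x)) = true) = P := filter_congr fun x _ => by simp
  have hPge : 2048 ≤ #P := by
    obtain ⟨x₁, hx₁⟩ := hodd
    have hRM := bb_rmWeight_holds (6 + 6) 1 (fun x => decide (Odd (u' x))) hℓ ⟨x₁, decide_eq_true hx₁⟩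
    rw [hfilt] at hRM
    norm_num at hRM
    omega
  have hPc : 2048 ≤ #(univ.filter fun x : Fin (6 + 6) → Bool => x ∉ P) := by
    have hPlt : #P < 4096 := by
      have hlt' : (#P : ℤ) < 4096 := by linarith
      exact_mod_cast hlt'
    have hne : ∃ x, x ∉ P := by
      by_contra hall
      push Not at hall
      have : #P = 4096 := by
        rw [show P = univ from eq_univ_of_forall hall, card_univ, Fintype.card_fun, Fintype.card_bool, Fintype.card_fin]; norm_num
      omega
    obtain ⟨x₂, hx₂⟩ := hne
    have hℓ' : IsDegLeFun 1 (fun x => decide (Odd (u' x)) ^^ true) := tb_isDegLeFun_xor_const hℓ true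
    have hRM := bb_rmWeight_holds (6 + 6) 1 (fun x => decide (Odd (u' x)) ^^ true) hℓ'
      ⟨x₂, by have := (hmemP x₂).not.1 hx₂; simpa using this⟩
    have hfilt' : (univ.filter fun x : Fin (6 + 6) → Bool => (decide (Odd (u' x)) ^^ true) = true) =
        univ.filter fun x : Fin (6 + 6) → Bool => x ∉ P := filter_congr fun x _ => by rw [hmemP]; simp
    rw [hfilt'] at hRM
    norm_num at hRM ⊢
    omega
  have hcardP : #P = 2048 := by
    have htot : #P + #(univ.filter fun x : Fin (6 + 6) → Bool => x ∉ P) = 4096 := by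
      have h := Finset.card_filter_add_card_filter_not (s := (univ : Finset (Fin (6 + 6) → Bool))) (fun x => x ∈ P)
      rw [card_univ, Fintype.card_fun, Fintype.card_bool, Fintype.card_fin] at h
      have e1 : (univ.filter fun x : Fin (6 + 6) → Bool => x ∈ P) = P := by ext x; simp
      rw [e1] at h
      norm_num at h
      exact h
    omega
  -- `P` is a coset of an xor-closed `V` with `2¹¹` elements
  have hmw := mw_flat_of_minweight 0 (fun x => decide (Odd (u' x))) hℓ (by rw [hfilt, hcardP]; norm_num)
  rw [hfilt] at hmw
  obtain ⟨h0, hadd, hcardV, hcoset⟩ := hmw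
  set V := univ.filter (fun a : Fin (6 + 6) → Bool => ∀ x, decide (Odd (u' (bxor x a))) = decide (Odd (u' x))) with hV
  obtain ⟨xP, hxP⟩ : P.Nonempty := card_pos.1 (by rw [hcardP]; norm_num)
  have hS : P = V.image (bxor xP) := hcoset xP (decide_eq_true ((hmemP xP).1 hxP))
  rw [hcardP] at hcardV
  have hcardV11 : #V = 2 ^ 11 := by rw [hcardV]; norm_num
  have hPV : ∀ x, x ∈ P → ∀ a ∈ V, bxor x a ∈ P := fun x hx a ha => fl1_coset_vadd hadd hS hx ha
  -- budget split
  have hPsum_ge : (2048 : ℤ) ≤ ∑ x ∈ P, e x ^ 2 := by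
    have h1 : ∑ x ∈ P, (1 : ℤ) ≤ ∑ x ∈ P, e x ^ 2 := sum_le_sum fun x hx => hsq1 x hx
    rw [sum_const, nsmul_eq_mul, mul_one, hcardP] at h1
    exact_mod_cast h1
  have hoff_le : ∑ x ∈ univ.filter (fun x => x ∉ P), e x ^ 2 ≤ 160 := by linarith
  have hon_le : ∑ x ∈ P, (e x ^ 2 - 1) ≤ 160 := by
    rw [sum_sub_distrib, sum_const, nsmul_eq_mul, mul_one, hcardP]; push_cast; linarith
  have hon_pos : 0 < ∑ x ∈ P, (e x ^ 2 - 1) + ∑ x ∈ univ.filter (fun x => x ∉ P), e x ^ 2 := by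
    rw [sum_sub_distrib, sum_const, nsmul_eq_mul, mul_one, hcardP]; push_cast; linarith
  -- the residual vanishes off `P`
  have hoff0 : ∀ y, y ∉ P → e y = 0 := tw5_off_flat f g hf hg u' hu' V xP h0 hadd hcardV11 hS hoff_le
  have hoff0sum : ∑ x ∈ univ.filter (fun x => x ∉ P), e x ^ 2 = 0 :=
    sum_eq_zero fun x hx => by rw [hoff0 x (mem_filter.1 hx).2]; norm_num
  -- the digit `D`, the sign `σ = −(−1)^D ≡ e (mod 4)` on `P`, and the wild part `ω`
  have hD : IsDegLeFun 3 (fun x => decide (Odd (u' x / 2))) := tw5_digit g hg u' hu' hℓ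
  set σ : (Fin (6 + 6) → Bool) → ℤ := fun x => - sZ (decide (Odd (u' x / 2))) with hσ
  set ω : (Fin (6 + 6) → Bool) → ℤ := fun x => (e x - σ x) / 4 with hω
  have hσval : ∀ x, σ x = 1 ∨ σ x = -1 := by
    intro x; simp only [σ]; rcases tp_sZ_cases (decide (Odd (u' x / 2))) with h | h <;> rw [h] <;> norm_num
  have hdec : ∀ x, x ∈ P → e x = σ x + 4 * ω x := by
    intro x hx
    have h1 := Int.odd_iff.1 ((hmemP x).1 hx)
    have h4 : (4 : ℤ) ∣ e x - σ x := by
      simp only [e, σ]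
      rcases tp_sZ_cases (f x) with hs | hs <;> rw [hs]
      · by_cases hq : Odd (u' x / 2)
        · have hq' := Int.odd_iff.1 hq
          simp only [hq, decide_true, sZ, if_true]; omega
        · have hq' : u' x / 2 % 2 = 0 := Int.even_iff.1 (Int.not_odd_iff_even.1 hq)
          simp only [hq, decide_false, sZ, Bool.false_eq_true, if_false]; omega
      · by_cases hq : Odd (u' x / 2)
        · have hq' := Int.odd_iff.1 hq
          simp only [hq, decide_true, sZ, if_true]; omega
        · have hq' : u' x / 2 % 2 = 0 := Int.even_iff.1 (Int.not_odd_iff_even.1 hq)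
          simp only [hq, decide_false, sZ, Bool.false_eq_true, if_false]; omega
    have := Int.mul_ediv_cancel' h4
    simp only [ω]
    linarith
  -- 7-flat sums inside `P`: `16 ∣ Σ e`, `8 ∣ Σ σ`, hence `Σ ω` is even
  have hflat7 : ∀ (b : Fin (6 + 6) → Bool) (a : Fin 7 → Fin (6 + 6) → Bool),
      (16 : ℤ) ∣ ∑ ε : Fin 7 → Bool, e (fun j => b j ^^ decide (Odd #(univ.filter fun i => ε i && a i j))) := by
    intro b a
    have h1 := fs_flat_sum_dvd (e := 5) g u hg hu b a (by norm_num)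
    obtain ⟨zf, hzf⟩ := sl_sum_sZ_flat f hf b a
    have hzf' : ∑ ε : Fin 7 → Bool, 2 * sZ (f (fun j => b j ^^ decide (Odd #(univ.filter fun i => ε i && a i j)))) = 16 * zf := by
      rw [← mul_sum, hzf]; norm_num; ring
    have h1' : 2 * 16 ∣ 2 * ∑ ε : Fin 7 → Bool, u' (fun j => b j ^^ decide (Odd #(univ.filter fun i => ε i && a i j))) := by
      rw [mul_sum]; norm_num at h1 ⊢; exact h1
    have h1'' := (mul_dvd_mul_iff_left (two_ne_zero (α := ℤ))).1 h1'
    have h3 : ∑ ε : Fin 7 → Bool, e (fun j => b j ^^ decide (Odd #(univ.filter fun i => ε i && a i j))) =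
        ∑ ε : Fin 7 → Bool, u' (fun j => b j ^^ decide (Odd #(univ.filter fun i => ε i && a i j))) -
        ∑ ε : Fin 7 → Bool, 2 * sZ (f (fun j => b j ^^ decide (Odd #(univ.filter fun i => ε i && a i j)))) := by
      rw [← sum_sub_distrib]
    rw [h3, hzf']
    exact dvd_sub h1'' (Dvd.intro _ rfl)
  have hωeven : ∀ x, x ∈ P → Even (ω x) := by
    rcases ws_erm_round V h0 hadd hcardV11 xP ω 6 (fun b hb a ha => by
        rw [← hS] at hb
        have hpts : ∀ ε : Fin (6 + 1) → Bool, (fun j => b j ^^ decide (Odd #(univ.filter fun i => ε i && a i j))) ∈ P :=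
          fun ε => ws_flatPt_mem V h0 (· ∈ P) hPV (6 + 1) b hb a ha ε
        have h16 := hflat7 b a
        obtain ⟨zσ, hzσ⟩ := sl_sum_sZ_flat (fun x => decide (Odd (u' x / 2))) hD b a
        have hσsum : ∑ ε : Fin (6 + 1) → Bool, σ (fun j => b j ^^ decide (Odd #(univ.filter fun i => ε i && a i j))) = - (8 * zσ) := by
          simp only [σ]; rw [sum_neg_distrib, hzσ]; norm_num
        rw [sum_congr rfl fun ε _ => hdec _ (hpts ε), sum_add_distrib, ← mul_sum, hσsum] at h16
        obtain ⟨k, hk⟩ := h16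
        exact ⟨2 * k + zσ, by linarith⟩) with hev | hbig
    · intro x hx; exact hev x (by rwa [← hS])
    · exfalso
      rw [← hS] at hbig
      -- `≥ 32` points of `P` with `ω` odd, each costing `e² − 1 ≥ 8`
      have hcost : ∀ x ∈ P.filter (fun x => Odd (ω x)), (8 : ℤ) ≤ e x ^ 2 - 1 := by
        intro x hx
        have hxP := (mem_filter.1 hx).1
        have ho := Int.odd_iff.1 (mem_filter.1 hx).2
        have hd := hdec x hxP
        rcases hσval x with hs | hs <;> rw [hs] at hd
        · have : e x ≤ -3 ∨ 3 ≤ e x := by omega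
          have := tp_sq_ge (k := 3) (by norm_num) this; linarith
        · have : e x ≤ -3 ∨ 3 ≤ e x := by omega
          have := tp_sq_ge (k := 3) (by norm_num) this; linarith
      have h1 : ∑ x ∈ P.filter (fun x => Odd (ω x)), (8 : ℤ) ≤ ∑ x ∈ P.filter (fun x => Odd (ω x)), (e x ^ 2 - 1) := sum_le_sum hcost
      have h2 : ∑ x ∈ P.filter (fun x => Odd (ω x)), (e x ^ 2 - 1) ≤ ∑ x ∈ P, (e x ^ 2 - 1) :=
        sum_le_sum_of_subset_of_nonneg (filter_subset _ _) (fun x hx _ => by have := hsq1 x hx; linarith)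
      rw [sum_const, nsmul_eq_mul] at h1
      norm_num at hbig
      have : (32 : ℤ) ≤ #(P.filter (fun x => Odd (ω x))) := by exact_mod_cast (by omega)
      linarith
  -- `m = ω/2`; the wild set `Wd = {m ≠ 0}` has `≤ 3` points, `|m| = 1` there
  set m : (Fin (6 + 6) → Bool) → ℤ := fun x => ω x / 2 with hm
  have hdec2 : ∀ x, x ∈ P → e x = σ x + 8 * m x := by
    intro x hx
    have h := hdec x hx
    have hmm : ω x = 2 * m x := (Int.mul_ediv_cancel' (even_iff_two_dvd.1 (hωeven x hx))).symm
    rw [h, hmm]; ring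
  have hcost48 : ∀ x, x ∈ P → m x ≠ 0 → 48 ≤ e x ^ 2 - 1 := by
    intro x hx hne
    have hd := hdec2 x hx
    rcases hσval x with hs | hs <;> rw [hs] at hd
    · have : e x ≤ -7 ∨ 7 ≤ e x := by omega
      have := tp_sq_ge (k := 7) (by norm_num) this; linarith
    · have : e x ≤ -7 ∨ 7 ≤ e x := by omega
      have := tp_sq_ge (k := 7) (by norm_num) this; linarith
  have hm1 : ∀ x, x ∈ P → m x = 0 ∨ m x = 1 ∨ m x = -1 := by
    intro x hx
    by_contra hc
    push Not at hc
    have hd := hdec2 x hx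
    have h15 : e x ≤ -15 ∨ 15 ≤ e x := by rcases hσval x with hs | hs <;> rw [hs] at hd <;> omega
    have h225 := tp_sq_ge (k := 15) (by norm_num) h15
    have h2 : e x ^ 2 - 1 ≤ ∑ y ∈ P, (e y ^ 2 - 1) :=
      single_le_sum (f := fun y => e y ^ 2 - 1) (fun y hy => by have := hsq1 y hy; linarith) hx
    linarith
  have hzero1 : ∀ x, x ∈ P → m x = 0 → e x ^ 2 - 1 = 0 := by
    intro x hx h0m
    have hd := hdec2 x hx
    rw [h0m] at hd
    rcases hσval x with hs | hs <;> rw [hs] at hd <;> rw [hd] <;> norm_num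
  set Wd := P.filter (fun x => m x ≠ 0) with hWd
  have hW3 : #Wd ≤ 3 := by
    have h1 : ∑ x ∈ Wd, (48 : ℤ) ≤ ∑ x ∈ Wd, (e x ^ 2 - 1) :=
      sum_le_sum fun x hx => hcost48 x (mem_filter.1 hx).1 (mem_filter.1 hx).2
    have h2 : ∑ x ∈ Wd, (e x ^ 2 - 1) ≤ ∑ x ∈ P, (e x ^ 2 - 1) :=
      sum_le_sum_of_subset_of_nonneg (filter_subset _ _) (fun x hx _ => by have := hsq1 x hx; linarith)
    rw [sum_const, nsmul_eq_mul] at h1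
    have h3 : (#Wd : ℤ) * 48 ≤ 160 := by linarith
    have h4 : (#Wd : ℤ) ≤ 3 := by omega
    exact_mod_cast h4
  have hWpos : 0 < #Wd := by
    by_contra hW0
    push Not at hW0
    have hWe : Wd = ∅ := card_eq_zero.1 (by omega)
    have hall0 : ∀ x, x ∈ P → m x = 0 := by
      intro x hx
      by_contra hne
      have : x ∈ Wd := mem_filter.2 ⟨hx, hne⟩
      rw [hWe] at this
      exact absurd this (by simp)
    have hPsum0 : ∑ x ∈ P, (e x ^ 2 - 1) = 0 := sum_eq_zero fun x hx => hzero1 x hx (hall0 x hx)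
    rw [hPsum0, hoff0sum] at hon_pos
    exact lt_irrefl _ hon_pos
  -- parity of a subset of the wild set from a divisibility: `2 ∣ Σ_{T} m ⇒ #(T ∩ Wd)` even
  have hpar : ∀ (T : Finset (Fin (6 + 6) → Bool)), T ⊆ P → (2 : ℤ) ∣ ∑ x ∈ T, m x → Even #(T.filter fun x => m x ≠ 0) := by
    intro T hT h2
    have hE := (tw_even_sum_iff T m).1 (even_iff_two_dvd.2 h2)
    have e1 : T.filter (fun x => Odd (m x)) = T.filter (fun x => m x ≠ 0) := by
      refine filter_congr fun x hx => ?_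
      rcases hm1 x (hT hx) with h | h | h <;> rw [h] <;> decide
    rwa [e1] at hE
  -- TWO-SIDED INPUT: Walsh inversion of `W_g = 32u'` against `W_f ∈ 32ℤ`
  have hsumP : ∀ (χ : (Fin (6 + 6) → Bool) → ℤ), ∑ x, e x * χ x = ∑ x ∈ P, e x * χ x := by
    intro χ
    rw [← sum_filter_add_sum_filter_not univ (fun x => x ∈ P)]
    have e1 : (univ.filter fun x : Fin (6 + 6) → Bool => x ∈ P) = P := by ext x; simp
    rw [e1, sum_eq_zero (s := univ.filter fun x => ¬ x ∈ P) (fun x hx => by rw [hoff0 x (mem_filter.1 hx).2, zero_mul]), add_zero]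
  obtain ⟨hinv0, -⟩ := tw5_inversion g u' hu' (0 : Fin (6 + 6))
  obtain ⟨k₀, hk₀⟩ := hfE zeroVec
  have hWf0 : ∑ x, sZ (f x) = 32 * k₀ := by
    have h : W (fun y => signOf (f y)) zeroVec = ∑ x, signOf (f x) := by
      show (∑ x, signOf (f x) * twist x zeroVec) = _
      exact sum_congr rfl fun x _ => by rw [twist_zeroVec_right, mul_one]
    have h' : ((∑ x, sZ (f x) : ℤ) : ℝ) = ((32 * k₀ : ℤ) : ℝ) := by push_cast; simp_rw [tp_sZ_cast]; rw [← h, hk₀]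
    exact_mod_cast h'
  -- at `z = 0`: `Σ_P σ + 8 Σ_P m ≡ 0 (mod 64)`
  have hz0 : (64 : ℤ) ∣ ∑ x ∈ P, σ x + 8 * ∑ x ∈ P, m x := by
    have h1 : ∑ x, u' x = 2 * ∑ x, sZ (f x) + ∑ x, e x * 1 := by
      rw [mul_sum, ← sum_add_distrib]; exact sum_congr rfl fun x _ => by simp only [e]; ring
    rw [hsumP (fun _ => 1), hinv0, hWf0, sum_congr rfl fun x hx => by rw [mul_one, hdec2 x hx], sum_add_distrib, ← mul_sum] at h1
    rcases tp_sZ_cases (g zeroVec) with hs | hs <;> rw [hs] at h1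
    · exact ⟨2 - k₀, by linarith⟩
    · exact ⟨-2 - k₀, by linarith⟩
  have hσP : (16 : ℤ) ∣ ∑ x ∈ P, σ x := by
    have h := (tw5_axP (fun x => decide (Odd (u' x))) (fun x => decide (Odd (u' x / 2))) hℓ hD 0).1
    rw [hfilt] at h
    simp only [σ]
    rw [sum_neg_distrib]
    exact (dvd_neg).2 h
  have hWeven : Even #Wd := by
    have h2 : (2 : ℤ) ∣ ∑ x ∈ P, m x := by
      obtain ⟨a, ha⟩ := hz0
      obtain ⟨b, hb⟩ := hσP
      exact ⟨4 * a - b, by linarith⟩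
    exact hpar P (Subset.refl _) h2
  -- so `#Wd = 2`: `Wd = {y₁, y₂}` with `y₁ ≠ y₂`; pick a separating coordinate `j`
  have hW2 : #Wd = 2 := by
    rcases hWeven with ⟨r, hr⟩
    omega
  obtain ⟨y₁, y₂, hne, hWd2⟩ := card_eq_two.1 hW2
  obtain ⟨j, hj⟩ := Function.ne_iff.1 hne
  -- at `z = e_j`: `Σ_{P, x_j = 0} σ + 8 Σ_{P, x_j = 0} m ≡ 0 (mod 32)`
  obtain ⟨-, hinvj⟩ := tw5_inversion g u' hu' j
  obtain ⟨kj, hkj⟩ := hfE (fun i => decide (i = j))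
  have hWfj : ∑ x, sZ (f x) * sZ (x j) = 32 * kj := by
    have h : W (fun y => signOf (f y)) (fun i => decide (i = j)) = ∑ x, signOf (f x) * signOf (x j) := by
      show (∑ x, signOf (f x) * twist x (fun i => decide (i = j))) = _
      exact sum_congr rfl fun x _ => by rw [twist_comm, tb_twist_single]
    have h' : ((∑ x, sZ (f x) * sZ (x j) : ℤ) : ℝ) = ((32 * kj : ℤ) : ℝ) := by push_cast; simp_rw [tp_sZ_cast]; rw [← h, hkj]
    exact_mod_cast h'
  have hzj : (64 : ℤ) ∣ ∑ x ∈ P, σ x * sZ (x j) + 8 * ∑ x ∈ P, m x * sZ (x j) := by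
    have h1 : ∑ x, u' x * sZ (x j) = 2 * ∑ x, sZ (f x) * sZ (x j) + ∑ x, e x * sZ (x j) := by
      rw [mul_sum, ← sum_add_distrib]; exact sum_congr rfl fun x _ => by simp only [e]; ring
    rw [hsumP (fun x => sZ (x j)), hinvj, hWfj, sum_congr rfl fun x hx => by rw [hdec2 x hx], ] at h1
    have e2 : ∑ x ∈ P, (σ x + 8 * m x) * sZ (x j) = ∑ x ∈ P, σ x * sZ (x j) + 8 * ∑ x ∈ P, m x * sZ (x j) := by
      rw [mul_sum, ← sum_add_distrib]; exact sum_congr rfl fun x _ => by ring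
    rw [e2] at h1
    rcases tp_sZ_cases (g (fun i => decide (i = j))) with hs | hs <;> rw [hs] at h1
    · exact ⟨2 - kj, by linarith⟩
    · exact ⟨-2 - kj, by linarith⟩
  -- restrict to `x_j = 0`: `1 + sZ (x j) = 2·[x j = false]`
  have hhalf : ∀ (F : (Fin (6 + 6) → Bool) → ℤ), ∑ x ∈ P, F x + ∑ x ∈ P, F x * sZ (x j) =
      2 * ∑ x ∈ P.filter (fun x => x j = false), F x := by
    intro F
    calc ∑ x ∈ P, F x + ∑ x ∈ P, F x * sZ (x j) = ∑ x ∈ P, (F x + F x * sZ (x j)) := by rw [sum_add_distrib]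
      _ = ∑ x ∈ P, (if x j = false then 2 * F x else 0) :=
          sum_congr rfl fun x _ => by cases x j <;> simp [sZ, two_mul]
      _ = ∑ x ∈ P.filter (fun x => x j = false), 2 * F x := (sum_filter (fun x => x j = false) (fun x => 2 * F x)).symm
      _ = 2 * ∑ x ∈ P.filter (fun x => x j = false), F x := by rw [← mul_sum]
  have hσPj : (16 : ℤ) ∣ ∑ x ∈ P.filter (fun x => x j = false), σ x := by
    have h := (tw5_axP (fun x => decide (Odd (u' x))) (fun x => decide (Odd (u' x / 2))) hℓ hD j).2
    have e1 : (univ.filter fun x : Fin (6 + 6) → Bool => decide (Odd (u' x)) = true ∧ x j = false) = P.filter (fun x => x j = false) := by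
      rw [hPdef, filter_filter]; exact filter_congr fun x _ => by simp
    rw [e1] at h
    simp only [σ]
    rw [sum_neg_distrib]
    exact (dvd_neg).2 h
  have hWjeven : Even #((P.filter fun x => x j = false).filter fun x => m x ≠ 0) := by
    have h2 : (2 : ℤ) ∣ ∑ x ∈ P.filter (fun x => x j = false), m x := by
      obtain ⟨a, ha⟩ := hz0
      obtain ⟨b, hb⟩ := hzj
      obtain ⟨c, hc⟩ := hσPj
      have hsum2 := hhalf σ
      have hsum3 := hhalf m
      -- `2(Σ' σ + 8 Σ' m) = (Σσ + 8Σm) + (Σσχ + 8Σmχ) = 64(a + b)`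
      have h4 : 2 * (∑ x ∈ P.filter (fun x => x j = false), σ x + 8 * ∑ x ∈ P.filter (fun x => x j = false), m x) = 64 * (a + b) := by
        linarith
      exact ⟨2 * (a + b) - c, by linarith⟩
    exact hpar _ (filter_subset _ _) h2
  -- but exactly one of `y₁, y₂` has `x_j = 0`
  have hcount : ((P.filter fun x => x j = false).filter fun x => m x ≠ 0) = Wd.filter (fun x => x j = false) := by
    ext x; simp only [hWd, mem_filter]; tauto
  rw [hcount, hWd2, filter_insert, filter_singleton] at hWjeven
  revert hWjeven
  cases h1 : y₁ j <;> cases h2 : y₂ j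
  · exact absurd (h1.trans h2.symm) hj
  · simp
  · simp
  · exact absurd (h1.trans h2.symm) hj

end Summit.QuantumAdvantage.QuantumAdvantage.Theorems.CubicForrelation.NearExactIsExact

end
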